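import Summits.NavierStokesRegularity.NavierStokesRegularity.Theorems.WakeRatchetEternalViscousRateCircuitPumpFixedSeed
import HarnessLib
import HarnessLib.Audit

/-!
# `WakeRatchet.EternalViscousRate` (stmt-NavierStokesRegularity-25647) — negative lemma modulo FINE-SCALE TODA PUMPS AT A FIXED SEED
# (census item (d): the clock box of the seeded graded Toda pump uniform in `lam ↓ 1` at fixed seed)

The helper `…CircuitPumpFixedSeed` proves `no_fine_todaPump_of_eternalViscousRate`: the crux BY NAME forbids, at every fixed seed
`ε ∈ (0, 1]`, exactly self-similar Type-I non-trivial solutions of the m = 2 seeded graded Toda circuit `T_ε ∈ E₂(2/ε)` at all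
sufficiently fine scale ratios.  This file files the contrapositive as a negative lemma modulo the EXPLICIT construction item

* `FineFixedSeedTodaPumps` (`@[conjecture]`): at SOME seed `ε ∈ (0, 1]`, Toda pumps of `T_ε` at arbitrarily fine scale ratios
  (`SolvesODE lam T_ε X ∧ IsDSS lam 1 X ∧ IsTypeI lam X ∧ IsNontrivial X` for `lam ∈ (1, lam₁)`, every `lam₁ > 1`);
* `EternalViscousRate_false_of_FineFixedSeedTodaPumps : FineFixedSeedTodaPumps → ¬ EternalViscousRate`.

Compared with the landed hold `WakeRatchetViscDSS.EternalViscousRate_false_of_ViscousBlockDSSWaves` (p608789: bare existence of a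
dissipation-balanced block-DSS profile on some fixed class), the hypothesis here is a CONCRETE ODE problem on one explicit two-mode
table — the fixed-seed continuation `lam ↓ 1` of the tree's PROVED pump `PerpetualPumpCircuitPump.todaPump_exists` (which has
`ε = ε(lam) → 0`).  WHY NOT CONSTRUCTED: the tree's clock box needs `ε ≤ exp(−C / log lam)` (clock errors `O(1/log(1/ε))` against the
covering margin `(lam^{1/5} − 1)/4`); no fixed-seed analysis of the `lam ↓ 1` (continuum) limit of the transfer gate exists in the tree
or in print; rotor-circuit numerics on ⟨25646⟩ (`εs(R) ≈ 0.2 R^{-0.6}`) see surviving fronts at fixed spread only above a positive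
threshold, consistent with the crux.  OPEN; no verdict changes.
HONEST FRAMING: MODEL lattice ODEs only (Tao 2016 §4, §6.4); nothing here is a statement about the Navier–Stokes equations; no registered
stub of skeleton 842b1374 is closed; no summit statement is proved or refuted.
-/

set_option linter.dupNamespace false

noncomputable section

open Set

namespace Summit.NavierStokesRegularity.NavierStokesRegularity.Theorems.WakeRatchetCircuitPumpNoUniform

open Summit.NavierStokesRegularity.NavierStokesRegularity.Theorems.CircuitPumpNegative

/-! ## The construction item and the negative lemma -/

/-- **Construction item for ⟨25647⟩ (census item (d)): FINE-SCALE TODA PUMPS AT A FIXED SEED.**  At SOME seed `ε ∈ (0, 1]` the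
m = 2 seeded graded Toda circuit `T_ε` (Tao class (4.2)–(4.3), `α = 2/5`; the explicit table of `PerpetualPump.CircuitPump`'s proof)
carries, at arbitrarily fine scale ratios `lam ↓ 1`, an exactly self-similar (period 1), Type-I, non-trivial solution on `(-∞, 0)`.
The tree proves this only with `ε = ε(lam) → 0` (`PerpetualPumpCircuitPump.todaPump_exists`); the fixed-seed clock box uniform in
`lam ↓ 1` is open.  Not constructed here.
[cite: Tao2016AveragedNS, §4 (4.1)–(4.3), Thm. 4.2 (statement shape); cell vocabulary (construction item for stmt-NavierStokesRegularity-25647)] -/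
@[conjecture] def FineFixedSeedTodaPumps : Prop :=
  ∃ ε : ℝ, 0 < ε ∧ ε ≤ 1 ∧ ∀ lam₁ : ℝ, 1 < lam₁ → ∃ lam : ℝ, 1 < lam ∧ lam < lam₁ ∧
    ∃ X : Fin 2 → ℤ → ℝ → ℝ, SolvesODE lam (fun (i₁ i₂ i₃ : Fin 2) (μ : Option (Fin 3)) => if μ = none then (if i₁ = 1 ∧ i₂ = 1 ∧ i₃ = 0
                then (-1 : ℝ) else if i₁ = 1 ∧ i₂ = 0 ∧ i₃ = 1 then 1 / 2 else if i₁ = 0 ∧ i₂ = 1 ∧ i₃ = 1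
                then 1 / 2 else if i₁ = 0 ∧ i₂ = 0 ∧ i₃ = 1 then ε else if i₁ = 0 ∧ i₂ = 1 ∧ i₃ = 0 then -ε /
                2 else if i₁ = 1 ∧ i₂ = 0 ∧ i₃ = 0 then -ε / 2 else 0) else if μ = some 2 then (if i₁ = 1 ∧
                i₂ = 1 ∧ i₃ = 0 then 1 else 0) else if μ = some 1 then (if i₁ = 1 ∧ i₂ = 0 ∧ i₃ = 1 then -1 /
                2 else 0) else (if i₁ = 0 ∧ i₂ = 1 ∧ i₃ = 1 then -1 / 2 else 0)) X ∧ IsDSS lam 1 X ∧ IsTypeI lam X ∧ IsNontrivial X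

/-- **Negative lemma: `FineFixedSeedTodaPumps → ¬ EternalViscousRate`.**  Contrapositive of
`no_fine_todaPump_of_eternalViscousRate`.  MODEL lattice only; no verdict changes (the hypothesis is open).
[cite: Tao2016AveragedNS, §4 Thm. 4.2 (statement shape), the viscous equation before it, §6.4; cell vocabulary (stmt-NavierStokesRegularity-25647)] -/
theorem EternalViscousRate_false_of_FineFixedSeedTodaPumps :
    FineFixedSeedTodaPumps →
      ¬ Summit.NavierStokesRegularity.NavierStokesRegularity.Theses.WakeRatchet.EternalViscousRate := by
  rintro ⟨ε, hε, hε1, H⟩ hK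
  obtain ⟨lam₁, hlam₁, hno⟩ := no_fine_todaPump_of_eternalViscousRate hK ε hε hε1
  obtain ⟨lam, hlam, hlt, X, hode, hdss, hTI, hnt⟩ := H lam₁ hlam₁
  exact hno lam hlam hlt X hode hdss hTI hnt

end Summit.NavierStokesRegularity.NavierStokesRegularity.Theorems.WakeRatchetCircuitPumpNoUniform

end
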